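import Summits.Ventures.CertifiedManyBodySolver.Downfold.PhaseMapRouterPrimaryCells
import Summits.Ventures.CertifiedManyBodySolver.Downfold.PhaseMapTablePooling

/-!
# Roads to a decided cell under an `UND:MIXED` primary: the CI default (v1.9 §3.3 (e), RULED), the unanimous-branch road (§3.3 (f),
# PROPOSED), and the band that bypasses both (F23)

Venture CertifiedManyBodySolver, cell `pub/hubbard-downfold`, seat hubbard-downfold-score-1 (second scoring engine);
namespace `Summit.Ventures.CertifiedManyBodySolver.Downfold.CellScore`. Context (2026-08-27): ACCEPTANCE §3.3 R-2W (c) forbids the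
«undetermined → not» upgrade under the primaries UND:MULTIORB / UND:HF / UND:DISPUTED / UND:STRUCT / UND:MIXED (the scorer flags W9);
director-hubbard RULED 04:34:55Z (Q-CI-1 ⇒ v1.9 §3.3 (e), effective after the 08-28 freeze run) that a `CI` annotation on a column of
KNOWN structure defaults its cells to «not» (≤ screening-grade) also under UND:MIXED / UND:FLAT; deputy-2 PROPOSED (PROPOSAL-v19f,
04:49Z, director F22 exit (b)) the «unanimous-branch road» (f): under UND:MIXED a cell may carry W ∈ {SC, not} iff the router lists
≥ 2 branches, EVERY listed branch speaks at that cell, and all say W (EPH speaks by its band: T < lo ⇒ SC, T > hi ⇒ not, silent inside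
the band or without a band). score-1's FINDING F23 (05:33Z): §4.5's band clause («SC if any band lo ≥ 0.1 K») is not conditioned on
the primary, so a T_c band carried on an UND column decides the MATERIAL whatever the cell words are — the `[]` (no band) hypothesis of
`verdict_UND_primary` (PhaseMapRouterPrimaryCells §2) is load-bearing and enforced by no rule. Everything below is PROVED.

WHAT THIS IS NOT: not a ruling (the pen's / the director's), not the assembler, and not a statement about any material — the kernel form
of the three roads' CONSEQUENCES for the §4.5 verdict and the class floors, so the (f) ruling can be read against exact statements:

* §1 F23. `verdict_UND_primary_band`: all cells written under an UND primary + ONE band with lo ≥ 1/10 ⇒ verdict SC; hence TP on a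
  known superconductor and FP on a non-superconductor (`kind_UND_primary_band`) — «TP / FP by e–ph band», with every cell undetermined.
  The fence the finding proposes (`verdictFenced`: ignore bands under an UND primary) restores ABSTAIN (`verdictFenced_UND`) and is the
  identity under a decided primary (`verdictFenced_decided`).
* §2 (e). The ruled CI default as a refinement of the assembler precedence: `primaryE` sends (UND:MIXED-or-FLAT, CI present, structure
  known) to the insulator default and everything else UND; `kind_ciDefault_e_nonSC` = TN again for La₂CuO₄-type members (the A10 γ
  event of `M13_event` reversed on CI columns), `primaryE_unknown_structure` / `primaryE_no_CI` = no road.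
* §3 (f). `Vote` (SC ∣ not ∣ silent), `ephVote` (the band rule), `unanimous` (strict reading as a total function to `Word`):
  undetermined with < 2 listed branches (`unanimous_lt_two`), with any silent branch (`unanimous_of_silent_mem`), with dissent
  (`unanimous_of_dissent`); `unanimous_eq_SC_iff` / `unanimous_eq_not_iff`; EPH inside its band is silent (`ephVote_inside`) and
  without a band is silent (`ephVote_none`); the LOOSE reading («every branch that HAS a statement») agrees with the strict one whenever
  the strict one decides (`loose_of_strict_SC` / `loose_of_strict_not`) and decides alone where the strict one abstains
  (`loose_decides_single_speaker`) — «deciding by fiat with extra steps», in the proposal's words.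
* §4 (f) × F23 — the CARRIER question. Reading α (EPH's statement carried as the column band): the material verdict is SC by the band
  for ANY cell words (`alpha_material_SC_any_words`), in particular when every (f) cell word is «not» (`alpha_TP_with_unanimous_not`) —
  so the proposal's «only «not» cells above T_c never make a known-SC cuprate a TP» needs the fence of §1 or another carrier.
  Reading β (R-2W (b): a channel CEILING T⁺): `cellingVote` never votes SC (`ceilingVote_ne_SC`) ⇒ the road never writes «SC»
  (`unanimous_beta_ne_SC`) — a «not»-only road.
* §5 numbers: the (e) shadow the director pre-stated (decided 3 → 4, cuprate 0/19 → 1/19 still < 0.60: `ciE_shadow_floor`), and the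
  F23 witness count (0 of 66 UND-primary columns carry a band on RUN #14: nothing to prove — an observation, printed by the engine as N18w).
-/

namespace Summit.Ventures.CertifiedManyBodySolver.Downfold

namespace CellScore

/-! ## §1 F23 — a band under an UND primary decides the material -/

/-- F23: cells all written under an UND primary (hence all `undetermined`, `cellsUnder_UND_all`) together with ONE band whose lower edge is
at least 1/10 K give verdict SC — §4.5's band clause reads the band whatever the primary. [folklore] -/
theorem verdict_UND_primary_band (Tfloor : ℚ) (grid : List (ℚ × Stage)) {lo hi : ℚ} (h : (1 : ℚ) / 10 ≤ lo)
    (bands : List (ℚ × ℚ)) :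
    verdict Tfloor (cellsUnder .UND grid) ((lo, hi) :: bands) = .SC :=
  verdict_cons_band h

/-- … so the confusion entry is TP on a known superconductor and FP on everything else: «TP / FP by e–ph band» with every cell word
undetermined (what-if 2026-08-27T05:3xZ on RUN #13's M19 Hg1201 ⇒ TP and M13 La₂CuO₄ x = 0 ⇒ FP, both engines, 0 warnings). [folklore] -/
theorem kind_UND_primary_band (Tfloor : ℚ) (grid : List (ℚ × Stage)) {lo hi : ℚ} (h : (1 : ℚ) / 10 ≤ lo)
    (bands : List (ℚ × ℚ)) (isSC : Bool) :
    kind (verdict Tfloor (cellsUnder .UND grid) ((lo, hi) :: bands)) isSC = (if isSC then .TP else .FP) := by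
  rw [verdict_UND_primary_band Tfloor grid h bands]; cases isSC <;> rfl

/-- Contrast (PhaseMapRouterPrimaryCells §2): WITHOUT a band the same cells ABSTAIN — the empty band list there is a load-bearing
hypothesis, not a convention. [folklore] -/
theorem kind_UND_primary_noband_vs_band (Tfloor : ℚ) (grid : List (ℚ × Stage)) {lo hi : ℚ} (h : (1 : ℚ) / 10 ≤ lo) (isSC : Bool) :
    kind (verdict Tfloor (cellsUnder .UND grid) []) isSC = .ABSTAIN ∧
      kind (verdict Tfloor (cellsUnder .UND grid) [(lo, hi)]) isSC ≠ .ABSTAIN := by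
  refine ⟨kind_UND_primary Tfloor grid isSC, ?_⟩
  rw [kind_UND_primary_band Tfloor grid h [] isSC]; cases isSC <;> decide

/-- The fence F23 proposes (stricter variant (i)): under an UND primary §4.5 ignores the bands (material verdict from cell words only);
under a decided primary nothing changes. `isUND` = the router primary is one of R-2W (c)'s UND tags. [folklore] -/
def verdictFenced (isUND : Bool) (Tfloor : ℚ) (cells : List (ℚ × Word)) (bands : List (ℚ × ℚ)) : Verdict :=
  verdict Tfloor cells (if isUND then [] else bands)

/-- Under the fence an UND-primary material ABSTAINS whatever bands ride on its columns. [folklore] -/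
theorem verdictFenced_UND (Tfloor : ℚ) (grid : List (ℚ × Stage)) (bands : List (ℚ × ℚ)) :
    verdictFenced true Tfloor (cellsUnder .UND grid) bands = .UNDETERMINED := by
  simp only [verdictFenced, if_true]; exact verdict_UND_primary Tfloor grid

/-- Under a decided primary the fence is the identity (so it is a no-op on every run of record, where no UND column carries a band and
every band sits under an EPH primary). [folklore] -/
theorem verdictFenced_decided (Tfloor : ℚ) (cells : List (ℚ × Word)) (bands : List (ℚ × ℚ)) :
    verdictFenced false Tfloor cells bands = verdict Tfloor cells bands := by
  simp [verdictFenced]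

/-! ## §2 v1.9 §3.3 (e) — the ruled CI default as a refinement of the precedence -/

/-- The (e) road as a map into the assembler precedence of PhaseMapRouterPrimaryCells: a column under an UND:MIXED / UND:FLAT primary
(`undMixedOrFlat = true`) whose router words carry the bare `CI` annotation AND whose structure at that P is KNOWN takes the insulator
default; every other UND column stays UND. (Decided primaries 1BH / 3BE / BI / CI with a CI annotation were `insulatorDefault` already.)
(Source: director-hubbard ruling Q-CI-1, 2026-08-27T04:34:55Z, ladder-directors/INBOX l.6059.) [folklore] -/
def primaryE (undMixedOrFlat hasCI structureKnown : Bool) : Primary :=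
  if undMixedOrFlat && hasCI && structureKnown then .insulatorDefault else .UND

/-- No CI annotation ⇒ no road: the column stays UND. [folklore] -/
theorem primaryE_no_CI (u k : Bool) : primaryE u false k = .UND := by
  cases u <;> cases k <;> rfl

/-- Structure of no record at that P ⇒ no road («NEVER under UND:DISPUTED / UND:STRUCT; structure of no record ⇒ envelope road only»).
[folklore] -/
theorem primaryE_unknown_structure (u c : Bool) : primaryE u c false = .UND := by
  cases u <;> cases c <;> rfl

/-- UND:MULTIORB / UND:HF / UND:DISPUTED / UND:STRUCT (`undMixedOrFlat = false`) ⇒ no road. [folklore] -/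
theorem primaryE_other_UND (c k : Bool) : primaryE false c k = .UND := by
  cases c <;> cases k <;> rfl

/-- All three conditions ⇒ the insulator default governs the column. [folklore] -/
theorem primaryE_road : primaryE true true true = .insulatorDefault := rfl

/-- THE (e) EVENT: a non-superconductor whose CI column has known structure, every cell the default «not» (no stage hand-in), at least one
cell at/above the floor ⇒ TN again — M13 La₂CuO₄ returns to the decided members it left at the A10 γ event (`M13_event`). [folklore] -/
theorem kind_ciDefault_e_nonSC (Tfloor : ℚ) (Ts : List ℚ) (hne : ∃ T ∈ Ts, Tfloor ≤ T) :
    kind (verdict Tfloor (cellsUnder (primaryE true true true) (Ts.map fun T => (T, Stage.none))) []) false = .TN := by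
  rw [primaryE_road]; exact kind_CI_default_nonSC Tfloor Ts hne

/-- … while the same grid WITHOUT the CI annotation (or without known structure) stays ABSTAIN. [folklore] -/
theorem kind_e_no_road (Tfloor : ℚ) (Ts : List ℚ) (c k : Bool) (h : (c && k) = false) (isSC : Bool) :
    kind (verdict Tfloor (cellsUnder (primaryE true c k) (Ts.map fun T => (T, Stage.none))) []) isSC = .ABSTAIN := by
  have : primaryE true c k = .UND := by
    cases c <;> cases k <;> simp_all [primaryE]
  rw [this]; exact kind_UND_primary Tfloor _ isSC

/-! ## §3 v1.9 §3.3 (f) — the unanimous-branch road as a total function -/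

/-- What one listed branch says at a cell: SC, not, or nothing. [folklore] -/
inductive Vote
  | SC
  | not
  | silent
  deriving DecidableEq, Repr

/-- The EPH branch's vote by the band rule of the proposal: with a band [lo, hi] of record, T < lo ⇒ SC, hi < T ⇒ not, otherwise silent;
no band of record ⇒ silent. (Source: hubbard-deputy-2 PROPOSAL-v19f (f).2, 2026-08-27T04:49Z.) [folklore] -/
def ephVote : Option (ℚ × ℚ) → ℚ → Vote
  | none, _ => .silent
  | some (lo, hi), T => if T < lo then .SC else if hi < T then .not else .silent

/-- No band of record ⇒ EPH is silent everywhere. [folklore] -/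
theorem ephVote_none (T : ℚ) : ephVote none T = .silent := rfl

/-- Inside its band (lo ≤ T ≤ hi) EPH is silent. [folklore] -/
theorem ephVote_inside {lo hi T : ℚ} (h1 : lo ≤ T) (h2 : T ≤ hi) : ephVote (some (lo, hi)) T = .silent := by
  simp [ephVote, not_lt.mpr h1, not_lt.mpr h2]

/-- Below the band EPH votes SC. [folklore] -/
theorem ephVote_below {lo hi T : ℚ} (h : T < lo) : ephVote (some (lo, hi)) T = .SC := by
  simp [ephVote, h]

/-- Above the band EPH votes not. [folklore] -/
theorem ephVote_above {lo hi T : ℚ} (hlh : lo ≤ hi) (h : hi < T) : ephVote (some (lo, hi)) T = .not := by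
  have : ¬ T < lo := not_lt.mpr (le_trans hlh (le_of_lt h))
  simp [ephVote, this, h]

/-- The STRICT reading of (f) as a total function: fewer than two listed branches ⇒ undetermined ((f).1); otherwise SC iff every vote is SC,
not iff every vote is not, else undetermined (a silent branch or a dissent blocks; (f).2–3). (Source: hubbard-deputy-2 PROPOSAL-v19f, strict reading.) [folklore] -/
def unanimous (votes : List Vote) : Word :=
  if votes.length < 2 then Word.undetermined
  else if votes.all (fun v => decide (v = Vote.SC)) then Word.SC
  else if votes.all (fun v => decide (v = Vote.not)) then Word.not
  else Word.undetermined

/-- (f).1: a single listed branch (or none) is not «mixed» — the cell stays undetermined whatever it says. [folklore] -/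
theorem unanimous_lt_two (votes : List Vote) (h : votes.length < 2) : unanimous votes = Word.undetermined := by
  simp [unanimous, h]

/-- The road writes SC iff at least two branches are listed and every one votes SC. [folklore] -/
theorem unanimous_eq_SC_iff (votes : List Vote) :
    unanimous votes = Word.SC ↔ 2 ≤ votes.length ∧ ∀ v ∈ votes, v = Vote.SC := by
  unfold unanimous
  split_ifs with h1 h2 h3
  · exact ⟨fun h => absurd h (by decide), fun h => absurd h.1 (by omega)⟩
  · have h2' : ∀ v ∈ votes, v = Vote.SC := by simpa [List.all_eq_true] using h2
    exact ⟨fun _ => ⟨by omega, h2'⟩, fun _ => rfl⟩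
  · have h2' : ∃ v ∈ votes, v ≠ Vote.SC := by simpa [List.all_eq_true] using h2
    obtain ⟨v, hv, hne⟩ := h2'
    exact ⟨fun h => absurd h (by decide), fun h => absurd (h.2 v hv) hne⟩
  · have h2' : ∃ v ∈ votes, v ≠ Vote.SC := by simpa [List.all_eq_true] using h2
    obtain ⟨v, hv, hne⟩ := h2'
    exact ⟨fun h => absurd h (by decide), fun h => absurd (h.2 v hv) hne⟩

/-- The road writes not iff at least two branches are listed and every one votes not. [folklore] -/
theorem unanimous_eq_not_iff (votes : List Vote) :
    unanimous votes = Word.not ↔ 2 ≤ votes.length ∧ ∀ v ∈ votes, v = Vote.not := by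
  unfold unanimous
  split_ifs with h1 h2 h3
  · exact ⟨fun h => absurd h (by decide), fun h => absurd h.1 (by omega)⟩
  · -- every vote SC (and there are ≥ 2): no vote is `not`
    have h2' : ∀ v ∈ votes, v = Vote.SC := by simpa [List.all_eq_true] using h2
    have hne : votes ≠ [] := by intro he; simp [he] at h1
    obtain ⟨v0, hv0⟩ := List.exists_mem_of_ne_nil votes hne
    refine ⟨fun h => absurd h (by decide), fun h => ?_⟩
    have := h.2 v0 hv0; rw [h2' v0 hv0] at this; exact absurd this (by decide)
  · have h3' : ∀ v ∈ votes, v = Vote.not := by simpa [List.all_eq_true] using h3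
    exact ⟨fun _ => ⟨by omega, h3'⟩, fun _ => rfl⟩
  · have h3' : ∃ v ∈ votes, v ≠ Vote.not := by simpa [List.all_eq_true] using h3
    obtain ⟨v, hv, hne⟩ := h3'
    exact ⟨fun h => absurd h (by decide), fun h => absurd (h.2 v hv) hne⟩

/-- (f).2 «every branch speaks»: one silent branch blocks the road. [folklore] -/
theorem unanimous_of_silent_mem (votes : List Vote) (h : Vote.silent ∈ votes) : unanimous votes = Word.undetermined := by
  match hw : unanimous votes with
  | Word.SC => exact absurd ((unanimous_eq_SC_iff votes).mp hw |>.2 _ h) (by decide)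
  | Word.not => exact absurd ((unanimous_eq_not_iff votes).mp hw |>.2 _ h) (by decide)
  | Word.undetermined => rfl

/-- (f).3 «unanimity»: a dissent (one SC vote and one not vote) blocks the road — printed, never resolved by precedence. [folklore] -/
theorem unanimous_of_dissent (votes : List Vote) (hS : Vote.SC ∈ votes) (hN : Vote.not ∈ votes) :
    unanimous votes = Word.undetermined := by
  match hw : unanimous votes with
  | Word.SC => exact absurd ((unanimous_eq_SC_iff votes).mp hw |>.2 _ hN) (by decide)
  | Word.not => exact absurd ((unanimous_eq_not_iff votes).mp hw |>.2 _ hS) (by decide)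
  | Word.undetermined => rfl

/-- EPH listed and the cell inside EPH's band ⇒ the road abstains there (the proposal's «near T_c the EPH branch is silent inside its own
band, so the decided cells are the far-from-band ones»). [folklore] -/
theorem unanimous_eph_inside (others : List Vote) {lo hi T : ℚ} (h1 : lo ≤ T) (h2 : T ≤ hi) :
    unanimous (ephVote (some (lo, hi)) T :: others) = Word.undetermined :=
  unanimous_of_silent_mem _ (by rw [ephVote_inside h1 h2]; exact List.mem_cons_self)

/-- EPH listed without a band of record ⇒ the road abstains everywhere (today's state for every cuprate: no e–ph hand-in exists). [folklore] -/
theorem unanimous_eph_noband (others : List Vote) (T : ℚ) :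
    unanimous (ephVote none T :: others) = Word.undetermined :=
  unanimous_of_silent_mem _ List.mem_cons_self

/-- Two box branches and EPH all saying «not» above the band: the road writes «not». [folklore] -/
theorem unanimous_example_not {lo hi T : ℚ} (hlh : lo ≤ hi) (h : hi < T) :
    unanimous [Vote.not, Vote.not, ephVote (some (lo, hi)) T] = Word.not := by
  rw [ephVote_above hlh h]; decide

/-- The LOOSE reading (the director's parenthesis «every branch that HAS a statement»): silent branches abstain from the vote instead of
blocking it; unanimity among the speakers, at least one speaker. (Source: hubbard-deputy-2 PROPOSAL-v19f «Open points (1)».) [folklore] -/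
def unanimousLoose (votes : List Vote) : Word :=
  let sp := votes.filter (fun v => decide (v ≠ Vote.silent))
  if sp.isEmpty then Word.undetermined
  else if sp.all (fun v => decide (v = Vote.SC)) then Word.SC
  else if sp.all (fun v => decide (v = Vote.not)) then Word.not
  else Word.undetermined

/-- Strict ⇒ loose (SC): wherever the strict road writes SC the loose one writes SC too. [folklore] -/
theorem loose_of_strict_SC (votes : List Vote) (h : unanimous votes = Word.SC) : unanimousLoose votes = Word.SC := by
  obtain ⟨hlen, hall⟩ := (unanimous_eq_SC_iff votes).mp h
  have hf : votes.filter (fun v => decide (v ≠ Vote.silent)) = votes :=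
    List.filter_eq_self.mpr fun v hv => by simp [hall v hv]
  have hne : votes ≠ [] := by intro he; simp [he] at hlen
  simp only [unanimousLoose, hf, List.isEmpty_iff, hne, if_false]
  rw [if_pos (List.all_eq_true.mpr fun v hv => by simp [hall v hv])]

/-- Strict ⇒ loose (not). [folklore] -/
theorem loose_of_strict_not (votes : List Vote) (h : unanimous votes = Word.not) : unanimousLoose votes = Word.not := by
  obtain ⟨hlen, hall⟩ := (unanimous_eq_not_iff votes).mp h
  have hf : votes.filter (fun v => decide (v ≠ Vote.silent)) = votes :=
    List.filter_eq_self.mpr fun v hv => by simp [hall v hv]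
  have hne : votes ≠ [] := by intro he; simp [he] at hlen
  obtain ⟨v0, hv0⟩ := List.exists_mem_of_ne_nil votes hne
  have hSC : votes.all (fun v => decide (v = Vote.SC)) = false := by
    rw [Bool.eq_false_iff]; intro hx
    have := List.all_eq_true.mp hx v0 hv0; simp [hall v0 hv0] at this
  simp only [unanimousLoose, hf, List.isEmpty_iff, hne, if_false, hSC]
  rw [if_pos (List.all_eq_true.mpr fun v hv => by simp [hall v hv])]; simp

/-- … but NOT conversely: with one speaker among silent branches the loose road decides where the strict road abstains — «a single
available branch decides under a MIXED word: deciding by fiat with extra steps» (the proposal's reason to prefer strict). [folklore] -/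
theorem loose_decides_single_speaker :
    unanimousLoose [Vote.not, Vote.silent, Vote.silent] = Word.not ∧
      unanimous [Vote.not, Vote.silent, Vote.silent] = Word.undetermined := by
  refine ⟨by decide, by decide⟩

/-! ## §4 (f) × F23 — where does the EPH statement ride? -/

/-- READING α (EPH's two-sided band carried as the column's `Tc_band_K`): §4.5 decides the MATERIAL SC from the band for ANY cell words —
in particular for the words the (f) road writes. [folklore] -/
theorem alpha_material_SC_any_words (Tfloor : ℚ) (cells : List (ℚ × Word)) {lo hi : ℚ} (h : (1 : ℚ) / 10 ≤ lo)
    (bands : List (ℚ × ℚ)) : verdict Tfloor cells ((lo, hi) :: bands) = .SC :=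
  verdict_cons_band h

/-- Hence under reading α a known-SC cuprate whose every (f) cell is a unanimous «not» ABOVE the band is nevertheless a TP — by the band,
not by the road (unit-tested in phasemap 1.8.6: 7 «not» cells above a [60, 120] band on M19 ⇒ TP). The proposal's floor paragraph
(«such materials are decided-and-consistent, never TP») therefore needs the §1 fence or another carrier. [folklore] -/
theorem alpha_TP_with_unanimous_not (Tfloor : ℚ) (Ts : List ℚ) {lo hi : ℚ} (h : (1 : ℚ) / 10 ≤ lo) :
    kind (verdict Tfloor (Ts.map fun T => (T, Word.not)) [(lo, hi)]) true = .TP := by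
  rw [alpha_material_SC_any_words Tfloor _ h []]; rfl

/-- … and with the §1 fence the same material is judged on its cell words: all «not» at/above the floor ⇒ verdict NOT (an FN on a known
superconductor if the words are wrong — an ordinary, visible miss instead of a TP by construction). [folklore] -/
theorem alpha_fenced_words_decide (Tfloor : ℚ) (Ts : List ℚ) (hne : ∃ T ∈ Ts, Tfloor ≤ T) {lo hi : ℚ} :
    verdictFenced true Tfloor (Ts.map fun T => (T, Word.not)) [(lo, hi)] = .NOT := by
  simp only [verdictFenced, if_true]
  have hcells : cellsUnder .insulatorDefault (Ts.map fun T => (T, Stage.none)) = Ts.map (fun T => (T, Word.not)) := by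
    simp only [cellsUnder, List.map_map]; rfl
  have hk := kind_CI_default_nonSC Tfloor Ts hne
  rw [hcells] at hk
  -- kind v false = TN forces v = NOT
  match hv : verdict Tfloor (Ts.map fun T => (T, Word.not)) [] with
  | .NOT => rfl
  | .SC => rw [hv] at hk; exact absurd hk (by decide)
  | .UNDETERMINED => rw [hv] at hk; exact absurd hk (by decide)

/-- READING β (R-2W (b) as written: the EPH branch's result under an UND primary is a channel CEILING T⁺ — «e–ph channel alone: no SC above
T⁺»): its vote is «not» above T⁺ and silent at or below (a ceiling never says SC). (Source: ACCEPTANCE v1.8 §3.3 R-2W (b).) [folklore] -/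
def ceilingVote (Tplus T : ℚ) : Vote :=
  if Tplus < T then .not else .silent

/-- A ceiling never votes SC. [folklore] -/
theorem ceilingVote_ne_SC (Tplus T : ℚ) : ceilingVote Tplus T ≠ Vote.SC := by
  unfold ceilingVote; split <;> decide

/-- Under reading β the road never writes «SC» (EPH is listed on every UND:MIXED cuprate of record): a «not»-only road, whose decided
materials are «NOT above T» verdicts — exactly the proposal's floor paragraph, with (f).2's two-sided band sentence moot. [folklore] -/
theorem unanimous_beta_ne_SC (others : List Vote) (Tplus T : ℚ) :
    unanimous (ceilingVote Tplus T :: others) ≠ Word.SC := by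
  intro h
  have := ((unanimous_eq_SC_iff _).mp h).2 (ceilingVote Tplus T) List.mem_cons_self
  exact ceilingVote_ne_SC Tplus T this

/-- β and α agree wherever β speaks: above a band whose upper edge is the ceiling, both say «not». [folklore] -/
theorem ceilingVote_eq_ephVote_above {lo hi T : ℚ} (hlh : lo ≤ hi) (h : hi < T) :
    ceilingVote hi T = ephVote (some (lo, hi)) T := by
  rw [ephVote_above hlh h]; simp [ceilingVote, h]

/-! ## §5 Numbers -/

/-- The (e) shadow the director pre-stated with the ruling (RUN #12/#14 v1 table): M13 returns as TN ⇒ decided members 3 → 4; the cuprate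
class numerator 0 → 1 of 19, which still fails the 0.60 floor (3·19 = 57 > 5·1), and the distance stays 12 − 1 = 11 conversions
(5·12 = 60 ≥ 57 > 55 = 5·11). (Source: director-hubbard ruling Q-CI-1 2026-08-27T04:34:55Z «shadow pre-stated (27g): decided 4/59, cuprate 1/19».) [folklore] -/
theorem ciE_shadow_floor :
    (3 : ℕ) + 1 = 4 ∧ Tally.meets (3 / 5) ⟨1, 19⟩ = false ∧ Tally.meets (3 / 5) ⟨12, 19⟩ = true ∧ Tally.meets (3 / 5) ⟨11, 19⟩ = false := by
  refine ⟨rfl, ?_, ?_, ?_⟩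
  · rw [Bool.eq_false_iff, Ne, Tally.meets_three_fifths_iff]; norm_num
  · rw [Tally.meets_three_fifths_iff]; norm_num
  · rw [Bool.eq_false_iff, Ne, Tally.meets_three_fifths_iff]; norm_num

/-! ## §6 APPEND (g7 — F24): under reading β the (f) road moves NO floor member
§4.5 NOT needs EVERY cell at/above T_floor to read «not»; under β the EPH branch is silent at every T ≤ T⁺, so those cells stay undetermined,
and SC is impossible (`unanimous_beta_ne_SC`, item 7). Hence «UND:MIXED+…+EPH» materials are ABSTAIN under (f)+β whenever the grid has a
cell with T_floor ≤ T ≤ T⁺ (known superconductors: T_floor = 1/10 K) — the road adds «not»-cell accuracy, never a floor member. -/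

/-- No «SC» cell, no band, and one `undetermined` cell at/above the floor ⇒ verdict UNDETERMINED (neither §4.5 clause fires). [folklore] -/
theorem verdict_undetermined_of_relevant_undetermined (Tfloor : ℚ) (cells : List (ℚ × Word))
    (hSC : ∀ c ∈ cells, c.2 ≠ Word.SC) (hex : ∃ c ∈ cells, Tfloor ≤ c.1 ∧ c.2 = Word.undetermined) :
    verdict Tfloor cells [] = .UNDETERMINED := by
  unfold verdict
  have h1 : saysSC cells [] = false := by
    rw [Bool.eq_false_iff, Ne, saysSC_eq_true_iff]
    rintro (⟨c, hcm, hcw⟩ | ⟨b, hbm, _⟩)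
    · exact hSC c hcm hcw
    · simp at hbm
  have h2 : saysNOT Tfloor cells [] = false := by
    rw [Bool.eq_false_iff]
    intro hn
    simp only [saysNOT, Bool.and_eq_true, Bool.not_eq_true', List.all_eq_true, decide_eq_true_eq] at hn
    obtain ⟨⟨-, hall⟩, -⟩ := hn
    obtain ⟨c, hc, hT, hw⟩ := hex
    have hrel : c ∈ relevant Tfloor cells := List.mem_filter.mpr ⟨hc, by simpa using hT⟩
    have := hall c hrel
    rw [hw] at this
    exact Word.noConfusion this
  simp [h1, h2]

/-- The cells the (f) road writes under β on a column whose box branches all say «not»: «not» above T⁺, `undetermined` at/below. [folklore] -/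
def betaRoadCells (Tplus : ℚ) (Ts : List ℚ) : List (ℚ × Word) :=
  Ts.map (fun T => (T, if Tplus < T then Word.not else Word.undetermined))

/-- No cell of the β road is «SC». [folklore] -/
theorem betaRoadCells_no_SC (Tplus : ℚ) (Ts : List ℚ) : ∀ c ∈ betaRoadCells Tplus Ts, c.2 ≠ Word.SC := by
  intro c hc
  simp only [betaRoadCells, List.mem_map] at hc
  obtain ⟨T, _, rfl⟩ := hc
  dsimp only
  split <;> decide

/-- **F24.** A grid point T with T_floor ≤ T ≤ T⁺ ⇒ ABSTAIN under (f)+β for EITHER truth class (no floor member, never TP/TN/FP/FN). [folklore] -/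
theorem kind_betaRoad_abstain (Tfloor Tplus : ℚ) (Ts : List ℚ) (hT : ∃ T ∈ Ts, Tfloor ≤ T ∧ T ≤ Tplus) (isSC : Bool) :
    kind (verdict Tfloor (betaRoadCells Tplus Ts) []) isSC = .ABSTAIN := by
  have hv : verdict Tfloor (betaRoadCells Tplus Ts) [] = .UNDETERMINED := by
    refine verdict_undetermined_of_relevant_undetermined Tfloor _ (betaRoadCells_no_SC Tplus Ts) ?_
    obtain ⟨T, hmem, hlo, hhi⟩ := hT
    refine ⟨(T, Word.undetermined), ?_, hlo, rfl⟩
    simp only [betaRoadCells, List.mem_map]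
    exact ⟨T, hmem, by simp [not_lt.mpr hhi]⟩
  rw [hv]; cases isSC <;> rfl

/-- On the T22 grid a known superconductor (T_floor = 1/10 K) stays ABSTAIN under (f)+β for every ceiling T⁺ ≥ 1/10 K (the cell T = 1/10
qualifies) ⇒ the v1 cuprate ceiling (RUN #14: 5/19, needs 12) is the same number with or without (f) v0.2. [folklore] -/
theorem t22_knownSC_betaRoad_abstain (Tplus : ℚ) (h : (1 : ℚ) / 10 ≤ Tplus) (isSC : Bool) :
    kind (verdict (1 / 10) (betaRoadCells Tplus
      ([0, 1/10, 3/10, 1, 2, 4, 6, 10, 15, 20, 30, 40, 50, 70, 100, 130, 160, 200, 250, 300, 350, 400] : List ℚ)) []) isSC = .ABSTAIN :=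
  kind_betaRoad_abstain _ _ _ ⟨1 / 10, by simp, le_refl _, h⟩ isSC

/-- The only escape: T⁺ < T_floor (a non-superconductor measured down to T_min > T⁺) ⇒ the «not» cells decide NOT (TN). [folklore] -/
theorem betaRoad_decides_below_floor :
    kind (verdict 2 (betaRoadCells 1 ([0, 4] : List ℚ)) []) false = .TN := by
  decide

end CellScore

end Summit.Ventures.CertifiedManyBodySolver.Downfold
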